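import Summits.ResolutionOfSingularities.ResolutionOfSingularities.Theorems.HilbertSamuelEliminationSigmaMaxModificationsCorridor3WLadderGradeZero
import HarnessLib

/-!
# [OURS · L1 W4.2] NEAR-STEP DICTIONARY for the W-ladder rows (crux `SigmaMaxModifications`,
# stmt-ResolutionOfSingularities-18506; conjunct `SigmaMaxModificationsCorridor3`, stmt-…-19249; line `w_ladder` v5b)

Stub worker res-L1-w42-stub-1 (gen 3). Helper file `--supports stmt-ResolutionOfSingularities-19249`; kernel only (no named
facts, no new definitions). Every W-row of the line of record (`stub_Wmono`, `stub_Wlow3M_char` at grades 0/1/2, the unit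
bridges, `IsoLowDirDimTerminatesM`, the W-top rows) reasons about ONE canonical near step `s → s'`
(`CampaignW42.CanonicalNearStep`) from a stage `s` reached from a MAXIMAL ORIGIN (`CampaignW42.IsMaximalOrigin`; scope
`Helpers.InScopeC = Moving.InScopeM`). This file packages, once, what such a step gives:

* §1 THE CYCLE INVARIANT ALONG `Reaches`: from a maximal origin with `ν ≠ Φ^{(N)}` every reached stage satisfies the
  hypotheses of the tree's `isCanonicalStep_cycle_package` (finite type over a field of characteristic `p`, reduced, `dim ≤ N`,
  `ν` never exceeded, label/pending bookkeeping) — written as an explicit conjunction (no new definition) — and hence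
  carries a `StateGood`; the marked point is closed and lies in the `ν`-stratum; the dimension of the stage does not exceed
  that of the origin (so the regime cut `QCharRegime`, read on the origin, transports to every stage).
* §2 THE CASE SPLIT: a canonical near step is either WAITING (the marked point is off the centre) or GENUINE
  (`s.IsBlownUp`); for a functional oracle the centre of the step is THE canonical centre.
* §3 WAITING STEPS CHANGE NOTHING LOCAL: the blow-down map is an isomorphism of local rings at the new marked point
  (tree `IsBlowup.isIso_compl`, `isIso_stalkMap_of_isIso_morphismRestrict`), hence `ē` is unchanged (for `e` see stub-2's
  `Moving.dirDim_eq_of_step_of_not_isBlownUp`)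
  (tree `Scheme.geomDirDim_eq_of_isIso_stalkMap` & co.): W-mono at waiting steps, unconditionally.
* §4 GENUINE STEPS = THE PRINTED-FACT SOCKET: the centre is REGULAR, PERMISSIBLE (CJS Def. 3.1) and INSIDE `X_n(ν)`, passes
  through the marked point, the stage is excellent of dimension `≤ N`, the blow-down map is a blow-up of that centre
  (`IsBlowup`) along which `H^N` does not increase, and the new marked point is a closed point over the old one with the same
  value `ν` of `H^N` — a NEAR point (CJS Def. 3.13 (1)). This is the antecedent list of CJS Thm. 3.10 (4) (W-mono) and
  of Thm. 3.14 (grade 0, unit starts).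

OURS bookkeeping over the tree's rendering of CJS Rem. 6.29 (1); NOT a statement of the manuscript [Hironaka2017] nor of
[CossartJannsenSaito2020]. AI-written; AI review is weaker than expert review.

## References
* V. Cossart, U. Jannsen, S. Saito, LNM 2270 (2020): Rem. 6.29 (1), p. 92, Def. 3.1, Thm. 3.10, Def. 3.13, Thm. 3.14.
  [CossartJannsenSaito2020]
* U. Görtz, T. Wedhorn, *Algebraic Geometry I* (2nd ed.), Prop. 13.91 (3). [GortzWedhorn2020]
-/

noncomputable section

set_option linter.dupNamespace false -- mandated namespace of this single-conjunct summit

open CategoryTheory AlgebraicGeometry TopologicalSpace Topology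

namespace Summit.ResolutionOfSingularities.ResolutionOfSingularities.Theorems

namespace CampaignW42

open Literature.AlgebraicGeometry.Resolution Literature.RingTheory.HilbertSamuel
open Summit.ResolutionOfSingularities.ResolutionOfSingularities.Theorems.SigmaMaxModificationsCorridor3

universe u

variable {p : ℕ} {R : ∀ S : Scheme.{u}, CentreSeq S → Prop} {N : ℕ} {ν : ℕ → ℕ}
variable {k : Type u} [Field k]

/-! ## §1. The cycle invariant, good states, closed marked points, strata and dimension along `Reaches` -/

/-- **THE CYCLE INVARIANT PROPAGATES ALONG ONE CANONICAL NEAR STEP** (tree `isCanonicalStep_cycle_package`, read at marked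
stages; admissible oracle, `ν ≠ Φ^{(N)}`). The invariant at `s` over the field `k`: finite type over `k`, reduced,
`dim ≤ N`, `ν` never exceeded, labels `≤` year, pending-replay bookkeeping. [cite: CossartJannsenSaito2020, Rem. 6.29 (1), p. 92] -/
theorem CanonicalNearStep.cycleInv (hRa : OracleAdmissible R) (hν : ν ≠ iterPSum N Phi) {s s' : MarkedStage.{u}}
    (h : CanonicalNearStep R N ν s s')
    (hk : ∃ f : s.W ⟶ Spec (.of k), LocallyOfFiniteType f ∧ QuasiCompact f) (hred : IsReduced s.W)
    (hdim : topologicalKrullDim s.W ≤ (N : WithBot ℕ∞))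
    (hsup : ∀ w : s.W, ν ≤ Scheme.hsFun s.W N w → Scheme.hsFun s.W N w = ν) (hlab : ∀ Z, s.L.label Z ≤ s.L.year)
    (hpend : ∀ Q, s.P = some Q → Set.range Q.hom.base = s.L.part (Scheme.hsStratum s.W N ν) Q.lbl ∧ Q.lbl ≤ s.L.year ∧
      Q.rest.AllPermissible ∧ Scheme.IsRegular Q.rest.top) :
    (∃ f : s'.W ⟶ Spec (.of k), LocallyOfFiniteType f ∧ QuasiCompact f) ∧ IsReduced s'.W ∧
      topologicalKrullDim s'.W ≤ (N : WithBot ℕ∞) ∧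
      (∀ w : s'.W, ν ≤ Scheme.hsFun s'.W N w → Scheme.hsFun s'.W N w = ν) ∧ (∀ Z, s'.L.label Z ≤ s'.L.year) ∧
      (∀ Q, s'.P = some Q → Set.range Q.hom.base = s'.L.part (Scheme.hsStratum s'.W N ν) Q.lbl ∧ Q.lbl ≤ s'.L.year ∧
        Q.rest.AllPermissible ∧ Scheme.IsRegular Q.rest.top) := by
  obtain ⟨C, P', hln, x', hst, -, -, -, rfl⟩ := h
  obtain ⟨-, -, -, -, hk', hred', hdim', hsup', hlab', hpend'⟩ :=
    isCanonicalStep_cycle_package (k := k) hRa hν hk hred hdim hsup hlab hpend hst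
  exact ⟨hk', hred', hdim', hsup', hlab', hpend'⟩

/-- **EVERY STAGE REACHED FROM A MAXIMAL ORIGIN SATISFIES THE CYCLE INVARIANT** over a field of definition of characteristic
`p` (admissible oracle, `ν ≠ Φ^{(N)}`): finite type, reduced, `dim ≤ N`, `ν` never exceeded by `H^N`, labels `≤` year, and the
pending-replay bookkeeping of `isCanonicalStep_cycle_package`. [cite: CossartJannsenSaito2020, Rem. 6.29 (1), p. 92] -/
theorem IsMaximalOrigin.cycleInv_of_reaches (hRa : OracleAdmissible R) (hν : ν ≠ iterPSum N Phi) {X : Scheme.{u}}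
    [IsLocallyNoetherian X] {x : X} (hX : IsMaximalOrigin p N ν X x) {s : MarkedStage.{u}}
    (hs : Reaches R N ν (MarkedStage.init X x) s) :
    ∃ (k : Type u) (_ : Field k) (_ : CharP k p),
      (∃ f : s.W ⟶ Spec (.of k), LocallyOfFiniteType f ∧ QuasiCompact f) ∧ IsReduced s.W ∧
      topologicalKrullDim s.W ≤ (N : WithBot ℕ∞) ∧
      (∀ w : s.W, ν ≤ Scheme.hsFun s.W N w → Scheme.hsFun s.W N w = ν) ∧ (∀ Z, s.L.label Z ≤ s.L.year) ∧
      (∀ Q, s.P = some Q → Set.range Q.hom.base = s.L.part (Scheme.hsStratum s.W N ν) Q.lbl ∧ Q.lbl ≤ s.L.year ∧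
        Q.rest.AllPermissible ∧ Scheme.IsRegular Q.rest.top) := by
  obtain ⟨k, _, _, f, -, hft, hqc⟩ := hX.exists_structure
  refine ⟨k, ‹_›, ‹_›, ?_⟩
  induction hs with
  | refl =>
    exact ⟨⟨f, hft, hqc⟩, hX.isReduced, hX.dim_le, fun w hw => le_antisymm (hX.maximal.2 ⟨w, rfl⟩ hw) hw,
      fun _ => le_rfl, fun Q hQ => absurd hQ (by simp [MarkedStage.init])⟩
  | tail _ hlast ih =>
    obtain ⟨hk, hred, hdim, hsup, hlab, hpend⟩ := ih
    exact hlast.cycleInv hRa hν hk hred hdim hsup hlab hpend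

/-- **THE CENTRE PACKAGE AT A REACHED STAGE.** At a stage `s` reached from a maximal origin (admissible oracle,
`ν ≠ Φ^{(N)}`), the centre `C` of any canonical step from `(s.L, s.P)` is REGULAR, lies INSIDE `X_n(ν)`, is PERMISSIBLE
(CJS Def. 3.1; Thm. 3.3 / Lemma 5.34 (3) in the tree's rendering), and `H^N` does not increase along its blow-up
(CJS Thm. 3.10 (1), proved in the tree). [cite: CossartJannsenSaito2020, Rem. 6.29 (1), Lemma 5.34 (3), Thm. 3.3, Thm. 3.10 (1)] -/
theorem IsMaximalOrigin.centre_package (hRa : OracleAdmissible R) (hν : ν ≠ iterPSum N Phi) {X : Scheme.{u}}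
    [IsLocallyNoetherian X] {x : X} (hX : IsMaximalOrigin p N ν X x) {s : MarkedStage.{u}}
    (hs : Reaches R N ν (MarkedStage.init X x) s) {C : s.W.IdealSheafData} {P' : Option (Pending (blowup C))}
    (hst : IsCanonicalStep R N ν s.L s.P C P') :
    Scheme.IsRegular C.subscheme ∧ (C.support : Set s.W) ⊆ Scheme.hsStratum s.W N ν ∧
      IdealSheafData.IsPermissible C ∧
      ∀ z : ↥(blowup C), Scheme.hsFun (blowup C) N z ≤ Scheme.hsFun s.W N ((blowup.π C).base z) := by
  obtain ⟨k, _, _, hk, hred, hdim, hsup, hlab, hpend⟩ := hX.cycleInv_of_reaches hRa hν hs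
  obtain ⟨hreg, hsub, hperm, hmono, -⟩ := isCanonicalStep_cycle_package (k := k) hRa hν hk hred hdim hsup hlab hpend hst
  exact ⟨hreg, hsub, hperm, hmono⟩

/-- A canonical near step carries a good state to a good state (`StateGood.next` for the step's centre). [folklore] -/
theorem CanonicalNearStep.stateGood {s s' : MarkedStage.{u}} (hg : StateGood k R N ν s.W s.L s.P)
    (h : CanonicalNearStep R N ν s s') : StateGood k R N ν s'.W s'.L s'.P := by
  obtain ⟨C, P', hln, x', hst, -, -, -, rfl⟩ := h
  exact hg.next hst

/-- Good states propagate along `Reaches`. [folklore] -/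
theorem Reaches.stateGood {s s' : MarkedStage.{u}} (hg : StateGood k R N ν s.W s.L s.P)
    (h : Reaches R N ν s s') : StateGood k R N ν s'.W s'.L s'.P := by
  induction h with
  | refl => exact hg
  | tail _ hst ih => exact hst.stateGood ih

/-- **The initial state of a maximal origin is good** (admissible oracle, `ν ≠ Φ^{(N)}`), over a field of definition of
characteristic `p`. [folklore] -/
theorem IsMaximalOrigin.exists_stateGood_init (hRa : OracleAdmissible R) {X : Scheme.{u}} [IsLocallyNoetherian X] {x : X}
    (hX : IsMaximalOrigin p N ν X x) (hν : ν ≠ iterPSum N Phi) :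
    ∃ (k : Type u) (_ : Field k) (_ : CharP k p), StateGood k R N ν X (Labelling.init X) none := by
  obtain ⟨k, _, _, f, -, hft, hqc⟩ := hX.exists_structure
  haveI := hX.isReduced
  exact ⟨k, ‹_›, ‹_›, stateGood_init_general hRa f hX.dim_le hX.maximal hν⟩

/-- **Every stage reached from a maximal origin carries a good state** (`ν ≠ Φ^{(N)}`). [folklore] -/
theorem IsMaximalOrigin.exists_stateGood_of_reaches (hRa : OracleAdmissible R) {X : Scheme.{u}}
    [IsLocallyNoetherian X] {x : X} (hX : IsMaximalOrigin p N ν X x) (hν : ν ≠ iterPSum N Phi) {s : MarkedStage.{u}}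
    (hs : Reaches R N ν (MarkedStage.init X x) s) :
    ∃ (k : Type u) (_ : Field k) (_ : CharP k p), StateGood k R N ν s.W s.L s.P := by
  obtain ⟨k, _, _, hg⟩ := hX.exists_stateGood_init (R := R) hRa hν
  have hg' : StateGood k R N ν (MarkedStage.init X x).W (MarkedStage.init X x).L (MarkedStage.init X x).P := hg
  exact ⟨k, ‹_›, ‹_›, Reaches.stateGood hg' hs⟩

/-- **In-scope stages (maximal origins, `Moving.InScopeM`) carry a good state** over a field of characteristic `p`
(`ν ≠ Φ^{(N)}`). [folklore] -/
theorem _root_.Summit.ResolutionOfSingularities.ResolutionOfSingularities.Theorems.SigmaMaxModificationsCorridor3.Moving.InScopeM.exists_stateGood (hRa : OracleAdmissible R) (hν : ν ≠ iterPSum N Phi) {s : MarkedStage.{u}}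
    (hs : Moving.InScopeM p R N ν s) :
    ∃ (k : Type u) (_ : Field k) (_ : CharP k p), StateGood k R N ν s.W s.L s.P := by
  obtain ⟨X, hX, x, horig, hreach⟩ := hs
  exact horig.exists_stateGood_of_reaches hRa hν hreach

/-- The two scope predicates over maximal origins used by the line agree (`Helpers.InScopeC` of W-mono, `Moving.InScopeM` of
the moving rows). [folklore] -/
theorem _root_.Summit.ResolutionOfSingularities.ResolutionOfSingularities.Theorems.SigmaMaxModificationsCorridor3.Helpers.inScopeC_iff_inScopeM {s : MarkedStage.{u}} : Helpers.InScopeC p R N ν s ↔ Moving.InScopeM p R N ν s := Iff.rfl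

/-- The marked point of a stage reached from a closed point is closed. [folklore] -/
theorem Reaches.isClosed_pt {X : Scheme.{u}} [IsLocallyNoetherian X] {x : X} (hx : IsClosed ({x} : Set X))
    {s : MarkedStage.{u}} (hs : Reaches R N ν (MarkedStage.init X x) s) : IsClosed ({s.pt} : Set s.W) := by
  induction hs with
  | refl => exact hx
  | tail _ hlast _ => exact hlast.isClosed_pt

/-- **IN-SCOPE MARKED POINTS LIE IN THE `ν`-STRATUM** (maximal origins). [folklore] -/
theorem _root_.Summit.ResolutionOfSingularities.ResolutionOfSingularities.Theorems.SigmaMaxModificationsCorridor3.Moving.InScopeM.pt_mem_hsStratum {s : MarkedStage.{u}} (hs : Moving.InScopeM p R N ν s) :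
    s.pt ∈ Scheme.hsStratum s.W N ν := by
  obtain ⟨X, hX, x, horig, hreach⟩ := hs
  exact Moving.pt_mem_hsStratum_of_reaches horig.mem_stratum hreach

/-- **IN-SCOPE MARKED POINTS ARE CLOSED** (maximal origins). [folklore] -/
theorem _root_.Summit.ResolutionOfSingularities.ResolutionOfSingularities.Theorems.SigmaMaxModificationsCorridor3.Moving.InScopeM.isClosed_pt {s : MarkedStage.{u}} (hs : Moving.InScopeM p R N ν s) : IsClosed ({s.pt} : Set s.W) := by
  obtain ⟨X, hX, x, horig, hreach⟩ := hs
  exact Reaches.isClosed_pt horig.isClosed hreach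

/-- In-scope stages have dimension `≤ N`. [folklore] -/
theorem _root_.Summit.ResolutionOfSingularities.ResolutionOfSingularities.Theorems.SigmaMaxModificationsCorridor3.Moving.InScopeM.dim_le {s : MarkedStage.{u}} (hs : Moving.InScopeM p R N ν s) :
    topologicalKrullDim s.W ≤ (N : WithBot ℕ∞) := by
  obtain ⟨X, hX, x, horig, hreach⟩ := hs
  exact Moving.dim_le_of_reaches (s₀ := MarkedStage.init X x) hreach horig.dim_le

/-- `ē ≤ N` at an in-scope stage. [folklore] -/
theorem _root_.Summit.ResolutionOfSingularities.ResolutionOfSingularities.Theorems.SigmaMaxModificationsCorridor3.Moving.InScopeM.geomDirDim_le {s : MarkedStage.{u}} (hs : Moving.InScopeM p R N ν s) : s.geomDirDim ≤ N := by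
  have h := (Helpers.geomDirDim_le_dim s).trans hs.dim_le
  exact_mod_cast h

/-- The scope is closed under one canonical near step. [folklore] -/
theorem _root_.Summit.ResolutionOfSingularities.ResolutionOfSingularities.Theorems.SigmaMaxModificationsCorridor3.Moving.InScopeM.step {s s' : MarkedStage.{u}} (hs : Moving.InScopeM p R N ν s) (h : CanonicalNearStep R N ν s s') :
    Moving.InScopeM p R N ν s' := by
  obtain ⟨X, hX, x, horig, hreach⟩ := hs
  exact ⟨X, hX, x, horig, hreach.tail h⟩

/-- The scope is closed under `Reaches`. [folklore] -/
theorem _root_.Summit.ResolutionOfSingularities.ResolutionOfSingularities.Theorems.SigmaMaxModificationsCorridor3.Moving.InScopeM.of_reaches {s s' : MarkedStage.{u}} (hs : Moving.InScopeM p R N ν s) (h : Reaches R N ν s s') :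
    Moving.InScopeM p R N ν s' := by
  obtain ⟨X, hX, x, horig, hreach⟩ := hs
  exact ⟨X, hX, x, horig, hreach.trans h⟩

/-- Along a chain of canonical near steps from an in-scope start, every term is in scope. [folklore] -/
theorem _root_.Summit.ResolutionOfSingularities.ResolutionOfSingularities.Theorems.SigmaMaxModificationsCorridor3.Moving.InScopeM.chain {c : ℕ → MarkedStage.{u}} (h0 : Moving.InScopeM p R N ν (c 0))
    (hstep : ∀ n, CanonicalNearStep R N ν (c n) (c (n + 1))) (n : ℕ) : Moving.InScopeM p R N ν (c n) :=
  h0.of_reaches (reaches_chain Relation.ReflTransGen.refl hstep n)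

/-! ## §2. The case split: WAITING versus GENUINE steps -/

/-- A canonical step whose centre passes through the marked point witnesses `IsBlownUp`. [folklore] -/
theorem MarkedStage.isBlownUp_of_mem {s : MarkedStage.{u}} {C : s.W.IdealSheafData}
    {P' : Option (Pending (blowup C))} (hst : IsCanonicalStep R N ν s.L s.P C P') (hmem : s.pt ∈ (C.support : Set s.W)) :
    s.IsBlownUp R N ν :=
  ⟨C, P', hst, hmem⟩

/-- **For a functional oracle, `IsBlownUp` is read on THE centre of the step**: if the marked point is blown up at `s`, then
the centre of ANY canonical step from `s` passes through it (`IsCanonicalStep.centre_unique`). [folklore] -/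
theorem MarkedStage.IsBlownUp.mem_support (hRf : OracleFunctional R) {s : MarkedStage.{u}} (hb : s.IsBlownUp R N ν)
    {C : s.W.IdealSheafData} {P' : Option (Pending (blowup C))} (hst : IsCanonicalStep R N ν s.L s.P C P') :
    s.pt ∈ (C.support : Set s.W) := by
  obtain ⟨C₀, P₀, hst₀, hmem⟩ := hb
  obtain rfl : C₀ = C := hst₀.centre_unique hRf hst
  exact hmem

/-- Conversely a step whose centre misses the marked point is not a blow-up of the marked point (functional oracle).
[folklore] -/
theorem MarkedStage.not_isBlownUp_of_not_mem (hRf : OracleFunctional R) {s : MarkedStage.{u}} {C : s.W.IdealSheafData}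
    {P' : Option (Pending (blowup C))} (hst : IsCanonicalStep R N ν s.L s.P C P') (hnot : s.pt ∉ (C.support : Set s.W)) :
    ¬ s.IsBlownUp R N ν :=
  fun hb => hnot (hb.mem_support hRf hst)

/-- **The data of a canonical near step, with the decision at the marked point**: the step `s → s'` is the blow-up of the stage
in a centre `C` named by the canonical step relation, the new marked point `x'` is closed, lies in the `ν`-stratum and over
the old marked point, and EITHER the old marked point is off the centre (WAITING) OR the marked point is blown up (GENUINE).
[folklore] -/
theorem CanonicalNearStep.cases {s s' : MarkedStage.{u}} (h : CanonicalNearStep R N ν s s') :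
    ∃ (C : s.W.IdealSheafData) (P' : Option (Pending (blowup C))) (hln : IsLocallyNoetherian (blowup C))
      (x' : ↥(blowup C)), IsCanonicalStep R N ν s.L s.P C P' ∧ (blowup.π C).base x' = s.pt ∧
        IsClosed ({x'} : Set ↥(blowup C)) ∧ x' ∈ Scheme.hsStratum (blowup C) N ν ∧
        s' = ⟨blowup C, hln, s.L.next (Scheme.hsStratum s.W N ν) C, P', x'⟩ ∧
        (s.pt ∉ (C.support : Set s.W) ∨ s.IsBlownUp R N ν) := by
  obtain ⟨C, P', hln, x', hst, hπ, hcl, hx', rfl⟩ := h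
  refine ⟨C, P', hln, x', hst, hπ, hcl, hx', rfl, ?_⟩
  by_cases hmem : s.pt ∈ (C.support : Set s.W)
  · exact Or.inr (MarkedStage.isBlownUp_of_mem hst hmem)
  · exact Or.inl hmem

/-! ## §3. WAITING steps: the local ring does not change -/

/-- **A WAITING step is a local isomorphism at the new marked point**: if the marked point of `s` is NOT blown up, then along
any canonical near step `s → s'` the blow-down map `π : X_{n+1} → X_n` satisfies `π(x_{n+1}) = x_n` and induces an
isomorphism `𝒪_{X_n,x_n} ≅ 𝒪_{X_{n+1},x_{n+1}}` (a blow-up is an isomorphism over the complement of its centre, GW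
Prop. 13.91 (3)). [cite: GortzWedhorn2020, Prop. 13.91 (3)] -/
theorem CanonicalNearStep.exists_isIso_stalkMap_of_not_isBlownUp {s s' : MarkedStage.{u}}
    (h : CanonicalNearStep R N ν s s') (hnb : ¬ s.IsBlownUp R N ν) :
    ∃ π : s'.W ⟶ s.W, π.base s'.pt = s.pt ∧ IsIso (π.stalkMap s'.pt) := by
  obtain ⟨C, P', hln, x', hst, hπ, -, -, rfl⟩ := h
  have hnot : s.pt ∉ (C.support : Set s.W) := fun hmem => hnb ⟨C, P', hst, hmem⟩
  haveI := s.ln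
  haveI := (blowup.isBlowup C).isIso_compl
  refine ⟨blowup.π C, hπ, ?_⟩
  exact isIso_stalkMap_of_isIso_morphismRestrict (blowup.π C) ⟨(C.support : Set s.W)ᶜ, C.support.isClosed.isOpen_compl⟩
    x' (by show (blowup.π C).base x' ∈ (C.support : Set s.W)ᶜ; rw [hπ]; exact hnot)

/-- **`ē` IS UNCHANGED ALONG A WAITING STEP** (`ē` depends only on the local ring, CJS Def. 2.26; tree
`Scheme.geomDirDim_eq_of_isIso_stalkMap`). [cite: CossartJannsenSaito2020, Def. 2.26] -/
theorem CanonicalNearStep.geomDirDim_eq_of_not_isBlownUp {s s' : MarkedStage.{u}} (h : CanonicalNearStep R N ν s s')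
    (hnb : ¬ s.IsBlownUp R N ν) : s'.geomDirDim = s.geomDirDim := by
  obtain ⟨π, hπ, hiso⟩ := h.exists_isIso_stalkMap_of_not_isBlownUp hnb
  letI := s.ln; letI := s'.ln
  show Scheme.geomDirDim s'.W s'.pt = Scheme.geomDirDim s.W s.pt
  rw [← hπ]
  exact Scheme.geomDirDim_eq_of_isIso_stalkMap π s'.pt

/-- The local rings along a waiting step are isomorphic (as rings). [folklore] -/
theorem CanonicalNearStep.nonempty_ringEquiv_stalk_of_not_isBlownUp {s s' : MarkedStage.{u}}
    (h : CanonicalNearStep R N ν s s') (hnb : ¬ s.IsBlownUp R N ν) :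
    Nonempty (s.W.presheaf.stalk s.pt ≃+* s'.W.presheaf.stalk s'.pt) := by
  obtain ⟨π, hπ, hiso⟩ := h.exists_isIso_stalkMap_of_not_isBlownUp hnb
  rw [← hπ]
  exact ⟨(asIso (π.stalkMap s'.pt)).commRingCatIsoToRingEquiv⟩

/-- **W-MONO AT WAITING STEPS, unconditionally**: `ē` does not increase (it is equal). [folklore] -/
theorem CanonicalNearStep.geomDirDim_le_of_not_isBlownUp {s s' : MarkedStage.{u}} (h : CanonicalNearStep R N ν s s')
    (hnb : ¬ s.IsBlownUp R N ν) : s'.geomDirDim ≤ s.geomDirDim :=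
  (h.geomDirDim_eq_of_not_isBlownUp hnb).le

/-! ## §4. GENUINE steps: the printed-fact socket (antecedents of CJS Thm. 3.10 / Def. 3.13 / Thm. 3.14) -/

/-- **GENUINE STEP PACKAGE.** Along a canonical near step `s → s'` from a stage REACHED FROM A MAXIMAL ORIGIN at which the
marked point IS blown up (functional admissible oracle, `ν ≠ Φ^{(N)}`): the step is the blow-up `π : X_{n+1} → X_n` of a centre
`C` which is REGULAR, PERMISSIBLE (CJS Def. 3.1) and contained in `X_n(ν)`, and passes through the marked point `x_n`;
`H^N` does not increase along `π` (CJS Thm. 3.10 (1), tree); the new marked point `x_{n+1}` is CLOSED, maps to `x_n`, and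
`H^N_{X_{n+1}}(x_{n+1}) = H^N_{X_n}(x_n) = ν` — `x_{n+1}` is NEAR to `x_n` (CJS Def. 3.13 (1)); the stage `X_n` is excellent of
dimension `≤ N`. [cite: CossartJannsenSaito2020, Def. 3.1, Thm. 3.10 (1), Def. 3.13 (1), Rem. 6.29 (1)] -/
theorem CanonicalNearStep.exists_genuine (hRf : OracleFunctional R) (hRa : OracleAdmissible R) (hν : ν ≠ iterPSum N Phi)
    {X : Scheme.{u}} [IsLocallyNoetherian X] {x : X} (hX : IsMaximalOrigin p N ν X x) {s s' : MarkedStage.{u}}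
    (hs : Reaches R N ν (MarkedStage.init X x) s) (h : CanonicalNearStep R N ν s s') (hb : s.IsBlownUp R N ν) :
    ∃ (C : s.W.IdealSheafData) (π : s'.W ⟶ s.W),
      IsBlowup π C ∧ Scheme.IsRegular C.subscheme ∧ IdealSheafData.IsPermissible C ∧
      s.pt ∈ (C.support : Set s.W) ∧ (C.support : Set s.W) ⊆ Scheme.hsStratum s.W N ν ∧
      π.base s'.pt = s.pt ∧ IsClosed ({s'.pt} : Set s'.W) ∧ IsClosed ({s.pt} : Set s.W) ∧
      Scheme.hsFun s'.W N s'.pt = Scheme.hsFun s.W N s.pt ∧ Scheme.hsFun s.W N s.pt = ν ∧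
      (∀ z : s'.W, Scheme.hsFun s'.W N z ≤ Scheme.hsFun s.W N (π.base z)) ∧
      Scheme.IsExcellent s.W ∧ topologicalKrullDim s.W ≤ (N : WithBot ℕ∞) := by
  have hpt : s.pt ∈ Scheme.hsStratum s.W N ν := Moving.pt_mem_hsStratum_of_reaches hX.mem_stratum hs
  have hcls : IsClosed ({s.pt} : Set s.W) := Reaches.isClosed_pt hX.isClosed hs
  obtain ⟨k, _, _, hg⟩ := hX.exists_stateGood_of_reaches hRa hν hs
  obtain ⟨C, P', hln, x', hst, hπ, hcl, hx', rfl⟩ := h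
  obtain ⟨hreg, hsub, hperm, hmono⟩ := hX.centre_package hRa hν hs hst
  letI := s.ln
  have hν' : Scheme.hsFun s.W N s.pt = ν := Scheme.mem_hsStratum_iff.mp hpt
  refine ⟨C, blowup.π C, blowup.isBlowup C, hreg, hperm, hb.mem_support hRf hst, hsub, hπ, hcl, hcls, ?_, hν', hmono,
    hg.isExcellent, hg.dim_le⟩
  show Scheme.hsFun (blowup C) N x' = Scheme.hsFun s.W N s.pt
  rw [Scheme.mem_hsStratum_iff.mp hx', hν']

/-- **GENUINE STEP PACKAGE, in-scope form** (`Moving.InScopeM`; the origin is hidden). [cite: CossartJannsenSaito2020, Def. 3.1, Def. 3.13 (1), Rem. 6.29 (1)] -/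
theorem CanonicalNearStep.exists_genuine_of_inScopeM (hRf : OracleFunctional R) (hRa : OracleAdmissible R)
    (hν : ν ≠ iterPSum N Phi) {s s' : MarkedStage.{u}} (hs : Moving.InScopeM p R N ν s) (h : CanonicalNearStep R N ν s s')
    (hb : s.IsBlownUp R N ν) :
    ∃ (C : s.W.IdealSheafData) (π : s'.W ⟶ s.W),
      IsBlowup π C ∧ Scheme.IsRegular C.subscheme ∧ IdealSheafData.IsPermissible C ∧
      s.pt ∈ (C.support : Set s.W) ∧ (C.support : Set s.W) ⊆ Scheme.hsStratum s.W N ν ∧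
      π.base s'.pt = s.pt ∧ IsClosed ({s'.pt} : Set s'.W) ∧ IsClosed ({s.pt} : Set s.W) ∧
      Scheme.hsFun s'.W N s'.pt = Scheme.hsFun s.W N s.pt ∧ Scheme.hsFun s.W N s.pt = ν ∧
      (∀ z : s'.W, Scheme.hsFun s'.W N z ≤ Scheme.hsFun s.W N (π.base z)) ∧
      Scheme.IsExcellent s.W ∧ topologicalKrullDim s.W ≤ (N : WithBot ℕ∞) := by
  obtain ⟨X, hX, x, horig, hreach⟩ := hs
  exact h.exists_genuine hRf hRa hν horig hreach hb

/-- **THE W-MONO ROW REDUCES TO GENUINE STEPS**: if `ē` does not increase along every GENUINE canonical near step from stages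
reached from maximal origins, then `Helpers.ClosedOriginGeomDirDimNonincrease p N` holds (waiting steps are local isomorphisms,
§3). The genuine case is CJS Thm. 3.10 (4) at a near point of a permissible blow-up, `K = k̄`, `δ = 0` (§4 socket).
[cite: CossartJannsenSaito2020, Thm. 3.10 (4)] -/
theorem _root_.Summit.ResolutionOfSingularities.ResolutionOfSingularities.Theorems.SigmaMaxModificationsCorridor3.Helpers.closedOriginGeomDirDimNonincrease_of_genuine
    (hgen : ∀ (R : ∀ S : Scheme.{u}, CentreSeq S → Prop), OracleFunctional R → OracleAdmissible R →
      ∀ (ν : ℕ → ℕ) (s s' : MarkedStage.{u}), Moving.InScopeM p R N ν s → CanonicalNearStep R N ν s s' →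
        s.IsBlownUp R N ν → s'.geomDirDim ≤ s.geomDirDim) :
    Helpers.ClosedOriginGeomDirDimNonincrease.{u} p N := by
  intro R hRf hRa ν s s' hs h
  by_cases hb : s.IsBlownUp R N ν
  · exact hgen R hRf hRa ν s s' hs h hb
  · exact h.geomDirDim_le_of_not_isBlownUp hb

end CampaignW42

end Summit.ResolutionOfSingularities.ResolutionOfSingularities.Theorems

end
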